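import Literature.Barriers.RiemannHypothesis.EpsteinZetaRealZerosIntegralWitness
import HarnessLib

/-!
# Low's grouping: the principal Epstein zeta function paired with a class of small `k`

Barrier audit (D-0021) of `Literature.Barriers.RiemannHypothesis.EpsteinZetaRealZeros`, continued
(generation 9, 2026-08-27). Everything in this file is PROVED (theorems only; no definitions, no named
facts).

`EpsteinZetaRealZerosSmallK.lean` closed the class-ISOLATED sign argument for `4 < d ≤ 144`: every
reduced class of such a discriminant `−d` has `k = √d/(2a) ≤ 6`, so every ideal-class Epstein zeta
function is negative on `(0, 1)` and `ζ(σ)L(σ, χ_{−d}) = ½Σ_Q Z_Q(σ) < 0`. From `d ≥ 200` the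
principal class `(1, b, c)` has `k = √d/2 > 7.0556` and its Epstein zeta function DOES vanish in
`(½, 1)` (`principalForm_realZero`), so the termwise argument is blocked. Low's remedy (1968) is to
GROUP the principal class with the other classes before taking signs: the completing factor
`c_d(σ) = π^σ(√d/2)^{−σ}/Γ(σ) > 0` relating `Z_Q(σ)` and `Λ_{z_Q}(σ)` (`continuation_ofReal_eq`)
depends on the discriminant only, so `Z_{Q₁}(σ) + Z_{Q₂}(σ) = c_d(σ)(Λ_{z₁}(σ) + Λ_{z₂}(σ))`, and the
constant-term decomposition `Λ_z(σ) = 2y^σΛ(2σ) + 2y^{1−σ}Λ(2 − 2σ) + E_z(σ)`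
(`Λ_eq_constantTerm_add_besselPart`) is LINEAR in the pair `(y^σ, y^{1−σ})`: the sum over a group of
classes is controlled by the same elementary inequality as a single class, with `y^u` (`u = 2σ − 1`)
replaced by the weighted mean `m(u) = Σ y_i^{(1−u)/2} y_i^u / Σ y_i^{(1−u)/2}` of the `y_i^u`.

## Results

* `pair_cell` — the weighted two-form version of `smallK_cell`: on a cell `p ≤ u ≤ q` the weight of
  the larger height `λ₁(u) = 1/(1 + (y₂/y₁)^{(1−u)/2})` is at most `1/(1 + ρ)` for any
  `ρ ≤ (y₂/y₁)^{(1−p)/2}`, so ONE rational check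
  `(1 − p)[(X − 1)/q + (1 + q)(M(X + 1) + β)] ≤ 2`, `X = (X₁ + ρX₂)/(1 + ρ)`, `X_i ≥ y_i^q`, gives the
  key inequality `P(u)(y₁^{(1+u)/2} + y₂^{(1+u)/2}) + (N(u) + β)(y₁^{(1−u)/2} + y₂^{(1−u)/2}) ≤ 0`,
  `P = M − 1/(1+u) + 1/u`, `N = M − 1/(1−u) − 1/u`, on the whole cell.
* `re_completedRiemannZeta₀_lt_fortySeven` — `Re Λ₀ < 47/1000` on `(0, 2]` (from the sharp values
  `Λ₀(1) < 0.0234`, `Λ₀(2) < 0.0236` and kernel non-negativity; `EpsteinZetaRealZerosSmallK` used `1/20`).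
* `re_Λ_add_re_Λ_lt_of_key` — **the analytic core**: for `1 ≤ y₂ ≤ y₁ ≤ 20`, `½ < σ < 1`, Bessel
  allowances `48√y_i e^{−1.4πy_i} ≤ 2β_i` and the key inequality with `β = β₁ + β₂ + δ`,
  `Re Λ_{z₁}(σ) + Re Λ_{z₂}(σ) < −4δ`.
* `re_add_re_neg_of_Ioo_half_one` — extension from `(½, 1)` to `(0, 1)`: reflection
  `Λ_z(1 − s) = Λ_z(s)` and, AT `σ = ½` (where the principal `Λ_{z₁}(½) > 0` for `y₁ > 7.0556`, so
  Bateman–Grosswald (11) is not available), continuity from the right together with a uniform margin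
  `−4δ₀` on an initial segment `(½, ½ + ε)`.
* `pair_re_neg_of_Λ` — transfer to arbitrary analytic continuations `Z₁`, `Z₂` of `ζ_{Q₁}`, `ζ_{Q₂}`
  (two forms of the same discriminant): `Re Z₁(σ) + Re Z₂(σ) < 0` on `(0, 1)`.
* `re_neg_of_mem_reducedForms_of_two_le` — for `d ≤ 576` every NON-principal reduced class
  (`a ≥ 2`) has `4/5 ≤ k ≤ 6`, hence is negative on `(0, 1)` on its own (`re_neg_of_starkK_le_six`).
* `LFunction_re_pos_of_pair` — **`Re L(σ, χ_{−d}) > 0` on `(0, 1)`** for the odd real primitive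
  character mod `d`, `4 < d ≤ 576`, as soon as the principal class, PAIRED with one other reduced class,
  is negative on `(0, 1)`: the remaining classes are negative individually, `ζ(σ) < 0`.

The instances (`d = 232, 267, 427`, the class-number-two discriminants in `(231, 436]` without a
Fekete–Pólya certificate of small order) are in `EpsteinZetaRealZerosPairGrouping232.lean` and its
siblings; they move the hypothesis-free floor `NoRealZeroUpTo 231` of
`Literature/NumberTheory/LFunctions/NoRealZeroSmallModuliIII.lean` past `d = 232`.

## References

* [Low1968] M. E. Low, *Real zeros of the Dedekind zeta function of an imaginary quadratic field*,
  Acta Arith. 14 (1968) 117–140: the class-aggregate use of the Chowla–Selberg / Bateman–Grosswald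
  expansion (`L_{−d}(s) ≠ 0` on `s > 0` for `d < 593000`, Theorem 5 via MR 38#4425).
* [Watkins2004RealZeros] M. Watkins, *Real zeros of real odd Dirichlet L-functions*, Math. Comp. 73
  (2004) 415–423, Theorem (p. 416): the same method, corrected and carried to `3·10⁸`.
* [BatemanGrosswald1964] P. T. Bateman, E. Grosswald, *On Epstein's zeta function*, Acta Arith. 9
  (1964) 365–373, Theorem 1 (3)–(5) (constant term), Theorem 3 (10)–(11).
-/

noncomputable section

open Complex Filter Topology MeasureTheory Set HurwitzZeta
open scoped UpperHalfPlane

namespace Literature.Barriers.RiemannHypothesis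

open Literature.NumberTheory.Automorphic
open Literature.NumberTheory.LFunctions.RealZeros

/-! ## `Re Λ₀ < 47/1000` on `(0, 2]` and the two one-sided bounds for `Λ(1 ± u)` -/

/-- **`Re Λ₀(w) < 47/1000` for real `0 < w ≤ 2`** (`Λ₀ ≤ 2Λ₀(1) < 0.0468` on `(0, 1)`,
`Λ₀ ≤ Λ₀(1) + Λ₀(2) < 0.0470` on `[1, 2]`). [folklore] -/
private theorem re_completedRiemannZeta₀_lt_fortySeven {w : ℝ} (h0 : 0 < w) (h2 : w ≤ 2) :
    (completedRiemannZeta₀ w).re < 47 / 1000 := by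
  have hA := re_completedRiemannZeta₀_one_lt_sharp
  have hB := re_completedRiemannZeta₀_two_lt_sharp
  rcases lt_or_ge w 1 with h1 | h1
  · have h := re_completedRiemannZeta₀_le h0 h1
    rw [re_completedRiemannZeta₀_zero_eq] at h
    linarith
  · have h := re_completedRiemannZeta₀_le_of_mem_Icc h1 h2
    linarith

/-- `Re Λ(1 + u) < 47/1000 − 1/(1 + u) + 1/u` for `0 < u < 1`. [folklore] -/
private theorem re_completedRiemannZeta_one_add_lt' {u : ℝ} (hu0 : 0 < u) (hu1 : u < 1) :
    (completedRiemannZeta ((1 + u : ℝ) : ℂ)).re < 47 / 1000 - 1 / (1 + u) + 1 / u := by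
  rw [completedRiemannZeta_eq]
  have hE := re_completedRiemannZeta₀_lt_fortySeven (w := 1 + u) (by linarith) (by linarith)
  have hσ : (1 / ((1 + u : ℝ) : ℂ)).re = 1 / (1 + u) := by
    rw [← Complex.ofReal_one, ← Complex.ofReal_div, Complex.ofReal_re]
  have hσ' : (1 / (1 - ((1 + u : ℝ) : ℂ))).re = -(1 / u) := by
    rw [← Complex.ofReal_one, ← Complex.ofReal_sub, ← Complex.ofReal_div, Complex.ofReal_re]
    rw [show (1 : ℝ) - (1 + u) = -u by ring, div_neg]
  simp only [sub_re, hσ, hσ']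
  linarith

/-- `Re Λ(1 − u) < 47/1000 − 1/(1 − u) − 1/u` for `0 < u < 1`. [folklore] -/
private theorem re_completedRiemannZeta_one_sub_lt' {u : ℝ} (hu0 : 0 < u) (hu1 : u < 1) :
    (completedRiemannZeta ((1 - u : ℝ) : ℂ)).re < 47 / 1000 - 1 / (1 - u) - 1 / u := by
  rw [completedRiemannZeta_eq]
  have hE := re_completedRiemannZeta₀_lt_fortySeven (w := 1 - u) (by linarith) (by linarith)
  have hσ : (1 / ((1 - u : ℝ) : ℂ)).re = 1 / (1 - u) := by
    rw [← Complex.ofReal_one, ← Complex.ofReal_div, Complex.ofReal_re]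
  have hσ' : (1 / (1 - ((1 - u : ℝ) : ℂ))).re = 1 / u := by
    rw [← Complex.ofReal_one, ← Complex.ofReal_sub, ← Complex.ofReal_div, Complex.ofReal_re]
    rw [show (1 : ℝ) - (1 - u) = u by ring]
  simp only [sub_re, hσ, hσ']
  linarith

/-! ## The weighted two-form cell lemma -/

/-- Weighted means with a bounded weight ratio: if `ρ w₁ ≤ w₂` (`w_i > 0`, `ρ > 0`) and `A₂ ≤ A₁`,
then `(w₁A₁ + w₂A₂)/(w₁ + w₂) ≤ (A₁ + ρA₂)/(1 + ρ)`. [folklore] -/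
private theorem weightedMean_le {w₁ w₂ ρ A₁ A₂ : ℝ} (hw1 : 0 < w₁) (hw2 : 0 < w₂) (hρ : 0 < ρ)
    (hρw : ρ * w₁ ≤ w₂) (hA : A₂ ≤ A₁) :
    (w₁ * A₁ + w₂ * A₂) / (w₁ + w₂) ≤ (A₁ + ρ * A₂) / (1 + ρ) := by
  rw [div_le_div_iff₀ (by linarith) (by linarith)]
  have h := mul_nonneg (sub_nonneg.2 hρw) (sub_nonneg.2 hA)
  have e : (A₁ + ρ * A₂) * (w₁ + w₂) - (w₁ * A₁ + w₂ * A₂) * (1 + ρ) =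
      (w₂ - ρ * w₁) * (A₁ - A₂) := by ring
  linarith

/-- **The two-form cell lemma.** Heights `1 ≤ y₂ ≤ y₁` with `y₂ = r y₁` (`r ≤ 1`), a cell
`p ≤ u ≤ q` in `(0, 1)`, rational data `y_i ≤ Y_i`, `Y_i^q ≤ X_i` (`X₂ ≤ X₁`) and
`0 < ρ ≤ r^{(1−p)/2}`, the last two given as INTEGER-power certificates `Y_i^{kq} ≤ X_i^{nq}`
(`q = kq/nq`) and `ρ^{ne} ≤ r^{ke}` (`(1−p)/2 = ke/ne`) so that `norm_num` decides them. Then the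
single check
`(1 − p)[(X − 1)/q + (1 + q)(M(X + 1) + β)] ≤ 2` with `X = (X₁ + ρX₂)/(1 + ρ)` yields
`P(u)(y₁^{(1+u)/2} + y₂^{(1+u)/2}) + (N(u) + β)(y₁^{(1−u)/2} + y₂^{(1−u)/2}) ≤ 0`,
`P = M − 1/(1+u) + 1/u`, `N = M − 1/(1−u) − 1/u`. Proof: with `w_i = y_i^{(1−u)/2}`, `x_i = y_i^u`
and the weighted mean `m = (w₁x₁ + w₂x₂)/(w₁ + w₂)` one has `ρw₁ ≤ w₂` (the weight ratio
`(y₂/y₁)^{(1−u)/2} ≥ r^{(1−p)/2} ≥ ρ`), so `m ≤ X` and `(m − 1)/u ≤ (X − 1)/q` (secant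
monotonicity `rpow_sub_one_div_le` termwise, then `weightedMean_le`); `smallK_alg_core` finishes.
This is the elementary inequality of Low's class-grouping for two classes. [cite: Low1968, Theorem 5 (via MR 38#4425)] -/
theorem pair_cell {y₁ y₂ r ρ Y₁ Y₂ X₁ X₂ p q u M β : ℝ} {kq nq ke ne : ℕ}
    (hy2 : 1 ≤ y₂) (h12 : y₂ ≤ y₁) (hr : y₂ = r * y₁) (hr1 : r ≤ 1)
    (hY1 : y₁ ≤ Y₁) (hY2 : y₂ ≤ Y₂) (hnq : nq ≠ 0) (hq : q * nq = kq)
    (hX1 : Y₁ ^ kq ≤ X₁ ^ nq) (hX2 : Y₂ ^ kq ≤ X₂ ^ nq) (hX20 : 0 ≤ X₂) (hX21 : X₂ ≤ X₁)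
    (hρ0 : 0 < ρ) (hne : ne ≠ 0) (he : (1 - p) / 2 * ne = ke) (hρ : ρ ^ ne ≤ r ^ ke)
    (hpu : p ≤ u) (hu0 : 0 < u) (huq : u ≤ q) (hu1 : u < 1) (hM : 0 ≤ M) (hβ : 0 ≤ β)
    (hcell : (1 - p) * (((X₁ + ρ * X₂) / (1 + ρ) - 1) / q +
      (1 + q) * (M * ((X₁ + ρ * X₂) / (1 + ρ) + 1) + β)) ≤ 2) :
    (M - 1 / (1 + u) + 1 / u) * (y₁ ^ ((1 + u) / 2) + y₂ ^ ((1 + u) / 2)) +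
      (M - 1 / (1 - u) - 1 / u + β) * (y₁ ^ ((1 - u) / 2) + y₂ ^ ((1 - u) / 2)) ≤ 0 := by
  have hy1 : 1 ≤ y₁ := hy2.trans h12
  have hy10 : 0 < y₁ := by linarith
  have hy20 : 0 < y₂ := by linarith
  have hq0 : 0 < q := lt_of_lt_of_le hu0 huq
  have hr0 : 0 < r := by
    by_contra h
    have : y₂ ≤ 0 := by rw [hr]; exact mul_nonpos_of_nonpos_of_nonneg (not_lt.1 h) hy10.le
    linarith
  -- the rational certificates as real-power bounds
  replace hX1 : Y₁ ^ q ≤ X₁ := rpow_le_of_pow_le (by linarith) (hX20.trans hX21) hnq hq hX1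
  replace hX2 : Y₂ ^ q ≤ X₂ := rpow_le_of_pow_le (by linarith) hX20 hnq hq hX2
  replace hρ : ρ ≤ r ^ ((1 - p) / 2) := le_rpow_of_pow_le hr0.le hρ0.le hne he hρ
  set X : ℝ := (X₁ + ρ * X₂) / (1 + ρ) with hXdef
  -- weights and powers
  set w₁ : ℝ := y₁ ^ ((1 - u) / 2) with hw₁
  set w₂ : ℝ := y₂ ^ ((1 - u) / 2) with hw₂
  set x₁ : ℝ := y₁ ^ u with hx₁
  set x₂ : ℝ := y₂ ^ u with hx₂
  have hw10 : 0 < w₁ := Real.rpow_pos_of_pos hy10 _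
  have hw20 : 0 < w₂ := Real.rpow_pos_of_pos hy20 _
  have hW : 0 < w₁ + w₂ := by linarith
  have e1 : y₁ ^ ((1 + u) / 2) = w₁ * x₁ := by
    rw [hw₁, hx₁, ← Real.rpow_add hy10]; congr 1; ring
  have e2 : y₂ ^ ((1 + u) / 2) = w₂ * x₂ := by
    rw [hw₂, hx₂, ← Real.rpow_add hy20]; congr 1; ring
  -- `ρ w₁ ≤ w₂`
  have hρw : ρ * w₁ ≤ w₂ := by
    have hexp : (1 - u) / 2 ≤ (1 - p) / 2 := by linarith
    have h1 : r ^ ((1 - p) / 2) ≤ r ^ ((1 - u) / 2) :=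
      Real.rpow_le_rpow_of_exponent_ge hr0 hr1 hexp
    have h2 : w₂ = r ^ ((1 - u) / 2) * w₁ := by
      rw [hw₂, hw₁, hr, Real.mul_rpow hr0.le hy10.le]
    rw [h2]
    exact mul_le_mul_of_nonneg_right (hρ.trans h1) hw10.le
  -- `1 ≤ x_i ≤ X_i` and the secant bounds
  have hx1one : 1 ≤ x₁ := Real.one_le_rpow hy1 hu0.le
  have hx2one : 1 ≤ x₂ := Real.one_le_rpow hy2 hu0.le
  have hx1X : x₁ ≤ X₁ := by
    calc x₁ ≤ y₁ ^ q := Real.rpow_le_rpow_of_exponent_le hy1 huq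
      _ ≤ Y₁ ^ q := Real.rpow_le_rpow hy10.le hY1 hq0.le
      _ ≤ X₁ := hX1
  have hx2X : x₂ ≤ X₂ := by
    calc x₂ ≤ y₂ ^ q := Real.rpow_le_rpow_of_exponent_le hy2 huq
      _ ≤ Y₂ ^ q := Real.rpow_le_rpow hy20.le hY2 hq0.le
      _ ≤ X₂ := hX2
  have hD1 : (x₁ - 1) / u ≤ (X₁ - 1) / q := by
    calc (x₁ - 1) / u ≤ (y₁ ^ q - 1) / q := rpow_sub_one_div_le hy1 hu0 huq
      _ ≤ (X₁ - 1) / q := by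
          apply div_le_div_of_nonneg_right _ hq0.le
          linarith [(Real.rpow_le_rpow hy10.le hY1 hq0.le).trans hX1]
  have hD2 : (x₂ - 1) / u ≤ (X₂ - 1) / q := by
    calc (x₂ - 1) / u ≤ (y₂ ^ q - 1) / q := rpow_sub_one_div_le hy2 hu0 huq
      _ ≤ (X₂ - 1) / q := by
          apply div_le_div_of_nonneg_right _ hq0.le
          linarith [(Real.rpow_le_rpow hy20.le hY2 hq0.le).trans hX2]
  -- the weighted mean `m`
  set m : ℝ := (w₁ * x₁ + w₂ * x₂) / (w₁ + w₂) with hmdef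
  have hm1 : 1 ≤ m := by
    rw [hmdef, le_div_iff₀ hW]
    have h1 := mul_le_mul_of_nonneg_left hx1one hw10.le
    have h2 := mul_le_mul_of_nonneg_left hx2one hw20.le
    linarith
  have hmX : m ≤ X := by
    calc m ≤ (w₁ * X₁ + w₂ * X₂) / (w₁ + w₂) := by
          rw [hmdef]
          refine div_le_div_of_nonneg_right ?_ hW.le
          have h1 := mul_le_mul_of_nonneg_left hx1X hw10.le
          have h2 := mul_le_mul_of_nonneg_left hx2X hw20.le
          linarith
      _ ≤ X := weightedMean_le hw10 hw20 hρ0 hρw hX21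
  have hmD : (m - 1) / u ≤ (X - 1) / q := by
    have em : (m - 1) / u = (w₁ * ((x₁ - 1) / u) + w₂ * ((x₂ - 1) / u)) / (w₁ + w₂) := by
      rw [hmdef]; field_simp; ring
    have eX : (X - 1) / q = ((X₁ - 1) / q + ρ * ((X₂ - 1) / q)) / (1 + ρ) := by
      rw [hXdef]; field_simp; ring
    rw [em, eX]
    calc (w₁ * ((x₁ - 1) / u) + w₂ * ((x₂ - 1) / u)) / (w₁ + w₂)
        ≤ (w₁ * ((X₁ - 1) / q) + w₂ * ((X₂ - 1) / q)) / (w₁ + w₂) := by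
          refine div_le_div_of_nonneg_right ?_ hW.le
          have h1 := mul_le_mul_of_nonneg_left hD1 hw10.le
          have h2 := mul_le_mul_of_nonneg_left hD2 hw20.le
          linarith
      _ ≤ ((X₁ - 1) / q + ρ * ((X₂ - 1) / q)) / (1 + ρ) :=
          weightedMean_le hw10 hw20 hρ0 hρw (div_le_div_of_nonneg_right (by linarith) hq0.le)
  -- the single-variable argument with `x := m`
  have hmD0 : 0 ≤ (m - 1) / u := div_nonneg (by linarith) hu0.le
  have hT0 : 0 ≤ M * (m + 1) + β := by positivity
  have hT : M * (m + 1) + β ≤ M * (X + 1) + β := by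
    have := mul_le_mul_of_nonneg_left (add_le_add_right hmX 1) hM
    linarith
  have H : (1 - u) * ((m - 1) / u) + (1 - u) * (1 + u) * (M * (m + 1) + β) ≤ 2 := by
    calc (1 - u) * ((m - 1) / u) + (1 - u) * (1 + u) * (M * (m + 1) + β)
        ≤ (1 - p) * ((X - 1) / q) + (1 - p) * (1 + q) * (M * (X + 1) + β) := by
          refine add_le_add (mul_le_mul (by linarith) hmD hmD0 (by linarith)) ?_
          refine mul_le_mul (mul_le_mul (by linarith) (by linarith) (by linarith) (by linarith))
            hT hT0 (mul_nonneg (by linarith) (by linarith))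
      _ = (1 - p) * ((X - 1) / q + (1 + q) * (M * (X + 1) + β)) := by ring
      _ ≤ 2 := hcell
  have hcore := smallK_alg_core hu0 hu1 H
  -- multiply by `w₁ + w₂ > 0`
  have emW : m * (w₁ + w₂) = w₁ * x₁ + w₂ * x₂ := by
    rw [hmdef]; field_simp
  rw [e1, e2]
  have h1 := mul_le_mul_of_nonneg_right hcore hW.le
  have : (m * (M - 1 / (1 + u) + 1 / u) + β) * (w₁ + w₂) =
      (M - 1 / (1 + u) + 1 / u) * (w₁ * x₁ + w₂ * x₂) + β * (w₁ + w₂) := by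
    rw [← emW]; ring
  rw [this] at h1
  linarith

/-! ## Bessel allowance on `3 ≤ y ≤ 20` -/

/-- `48√y e^{−1.4πy} ≤ 2/1000` for `3 ≤ y ≤ 20` (`e^{−1.4πy} ≤ e^{−12} < 49^{−3}`, `√20 < 4.48`):
the allowance for Bateman–Grosswald's remainder `H(s)` (`norm_epsteinBesselPart_le`) on this range
of heights. [cite: BatemanGrosswald1964, Theorem 2 (8)] -/
theorem bessel_allowance_of_three_le {y : ℝ} (hy3 : 3 ≤ y) (hy20 : y ≤ 20) :
    48 * Real.sqrt y * Real.exp (-(7 / 5) * Real.pi * y) ≤ 2 * (1 / 1000) := by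
  have hπ := Real.pi_gt_three
  have he4 := exp_neg_four_lt
  have he0 : 0 < Real.exp (-4) := Real.exp_pos _
  have hexp : Real.exp (-(7 / 5) * Real.pi * y) ≤ (1 / 49) ^ 3 := by
    have e12 : Real.exp (-12) = Real.exp (-4) ^ 3 := by
      rw [show (-12 : ℝ) = (3 : ℕ) * (-4) by norm_num, Real.exp_nat_mul]
    refine le_trans (Real.exp_le_exp.2 ?_) (e12.le.trans ?_)
    · nlinarith
    · exact pow_le_pow_left₀ he0.le he4.le 3
  have hs : Real.sqrt y ≤ 4.48 := by
    refine (Real.sqrt_le_sqrt hy20).trans ?_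
    rw [Real.sqrt_le_left (by norm_num)]; norm_num
  calc 48 * Real.sqrt y * Real.exp (-(7 / 5) * Real.pi * y) ≤ 48 * 4.48 * (1 / 49) ^ 3 :=
        mul_le_mul (mul_le_mul_of_nonneg_left hs (by norm_num)) hexp (Real.exp_pos _).le
          (by positivity)
    _ ≤ _ := by norm_num

/-! ## The analytic core: a pair of heights on `(½, 1)` -/

/-- **Analytic core of the grouping.** For `z₁, z₂ ∈ ℍ` with `1 ≤ y₂ = Im z₂ ≤ y₁ = Im z₁`,
`½ < σ < 1`, `u = 2σ − 1`, Bessel allowances `48√y_i e^{−1.4πy_i} ≤ 2β_i` and the key inequality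
`P(u)(y₁^σ + y₂^σ) + (N(u) + β₁ + β₂ + δ)(y₁^{1−σ} + y₂^{1−σ}) ≤ 0` (`M = 47/1000`):
`Re Λ_{z₁}(σ) + Re Λ_{z₂}(σ) < −4δ`. Each `Λ_{z_i}(σ)` is decomposed by
`Λ_eq_constantTerm_add_besselPart`; the two bounds `re_completedRiemannZeta_one_add_lt'`,
`re_completedRiemannZeta_one_sub_lt'` are one-sided in the right direction because `y_i^σ`,
`y_i^{1−σ} > 0`, and `y_i^{1−σ} ≥ 1` absorbs the allowances. [cite: Low1968, Theorem 5 (via MR 38#4425)] -/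
theorem re_Λ_add_re_Λ_lt_of_key (z₁ z₂ : ℍ) (hy2 : 1 ≤ z₂.im) (h21 : z₂.im ≤ z₁.im)
    {σ : ℝ} (hσ : 1 / 2 < σ) (hσ1 : σ < 1) {β₁ β₂ δ : ℝ} (hβ1 : 0 ≤ β₁) (hβ2 : 0 ≤ β₂)
    (hδ : 0 ≤ δ)
    (hE1 : 48 * Real.sqrt z₁.im * Real.exp (-(7 / 5) * Real.pi * z₁.im) ≤ 2 * β₁)
    (hE2 : 48 * Real.sqrt z₂.im * Real.exp (-(7 / 5) * Real.pi * z₂.im) ≤ 2 * β₂)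
    (hkey : (47 / 1000 - 1 / (1 + (2 * σ - 1)) + 1 / (2 * σ - 1)) * (z₁.im ^ σ + z₂.im ^ σ) +
      (47 / 1000 - 1 / (1 - (2 * σ - 1)) - 1 / (2 * σ - 1) + (β₁ + β₂ + δ)) *
        (z₁.im ^ (1 - σ) + z₂.im ^ (1 - σ)) ≤ 0) :
    ((thetaFEPair z₁).Λ σ).re + ((thetaFEPair z₂).Λ σ).re < -(4 * δ) := by
  have hy1 : 1 ≤ z₁.im := hy2.trans h21
  set u : ℝ := 2 * σ - 1 with hu
  have hu0 : 0 < u := by rw [hu]; linarith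
  have hu1 : u < 1 := by rw [hu]; linarith
  have hσ0 : (0 : ℝ) < σ := by linarith
  have h0 : (σ : ℂ) ≠ 0 := by exact_mod_cast hσ0.ne'
  have h1 : (σ : ℂ) ≠ 1 := by exact_mod_cast hσ1.ne
  have hh : (σ : ℂ) ≠ 1 / 2 := by
    intro h
    have := congrArg Complex.re h
    simp at this
    linarith
  have hP := re_completedRiemannZeta_one_add_lt' hu0 hu1
  have hN := re_completedRiemannZeta_one_sub_lt' hu0 hu1
  -- one height at a time: `Re Λ_z(σ) < 2y^σ P + 2y^{1−σ} N + 2β`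
  have single : ∀ (z : ℍ), 1 ≤ z.im → ∀ β : ℝ,
      48 * Real.sqrt z.im * Real.exp (-(7 / 5) * Real.pi * z.im) ≤ 2 * β →
      ((thetaFEPair z).Λ σ).re < 2 * z.im ^ σ * (47 / 1000 - 1 / (1 + u) + 1 / u) +
        2 * z.im ^ (1 - σ) * (47 / 1000 - 1 / (1 - u) - 1 / u) + 2 * β := by
    intro z hz β hEz
    set y := z.im with hydef
    have hy0 : 0 < y := by linarith
    have hdec := Λ_eq_constantTerm_add_besselPart z hz h0 h1 hh
    have eA : (2 * ((y : ℝ) : ℂ) ^ (σ : ℂ) * completedRiemannZeta (2 * (σ : ℂ))).re =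
        2 * y ^ σ * (completedRiemannZeta ((1 + u : ℝ) : ℂ)).re := by
      rw [show (2 : ℂ) * (σ : ℂ) = ((1 + u : ℝ) : ℂ) by rw [hu]; push_cast; ring,
        ← Complex.ofReal_cpow hy0.le,
        show (2 : ℂ) * ((y ^ σ : ℝ) : ℂ) = ((2 * y ^ σ : ℝ) : ℂ) by push_cast; ring,
        Complex.re_ofReal_mul]
    have eB : (2 * ((y : ℝ) : ℂ) ^ (1 - (σ : ℂ)) * completedRiemannZeta (2 - 2 * (σ : ℂ))).re =
        2 * y ^ (1 - σ) * (completedRiemannZeta ((1 - u : ℝ) : ℂ)).re := by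
      rw [show (2 : ℂ) - 2 * (σ : ℂ) = ((1 - u : ℝ) : ℂ) by rw [hu]; push_cast; ring,
        show (1 : ℂ) - (σ : ℂ) = ((1 - σ : ℝ) : ℂ) by push_cast; ring, ← Complex.ofReal_cpow hy0.le,
        show (2 : ℂ) * ((y ^ (1 - σ) : ℝ) : ℂ) = ((2 * y ^ (1 - σ) : ℝ) : ℂ) by push_cast; ring,
        Complex.re_ofReal_mul]
    have hyσ : 0 < y ^ σ := Real.rpow_pos_of_pos hy0 σ
    have hy1σ0 : 0 < y ^ (1 - σ) := Real.rpow_pos_of_pos hy0 _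
    have hE : (epsteinBesselPart z σ).re ≤ 2 * β := by
      have hn := norm_epsteinBesselPart_le z hz (s := (σ : ℂ)) (by simp; linarith)
        (by simp; linarith)
      exact ((Complex.re_le_norm _).trans hn).trans hEz
    have hA : 2 * y ^ σ * (completedRiemannZeta ((1 + u : ℝ) : ℂ)).re <
        2 * y ^ σ * (47 / 1000 - 1 / (1 + u) + 1 / u) := by nlinarith
    have hB : 2 * y ^ (1 - σ) * (completedRiemannZeta ((1 - u : ℝ) : ℂ)).re <
        2 * y ^ (1 - σ) * (47 / 1000 - 1 / (1 - u) - 1 / u) := by nlinarith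
    rw [hdec, Complex.add_re, Complex.add_re, eA, eB]
    linarith
  have hS1 := single z₁ hy1 β₁ hE1
  have hS2 := single z₂ hy2 β₂ hE2
  -- the key inequality, `y^{1−σ} ≥ 1`
  have hw1 : 1 ≤ z₁.im ^ (1 - σ) := Real.one_le_rpow hy1 (by linarith)
  have hw2 : 1 ≤ z₂.im ^ (1 - σ) := Real.one_le_rpow hy2 (by linarith)
  have hβ : 0 ≤ β₁ + β₂ + δ := by linarith
  have hkey' : (47 / 1000 - 1 / (1 + u) + 1 / u) * (z₁.im ^ σ + z₂.im ^ σ) +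
      (47 / 1000 - 1 / (1 - u) - 1 / u) * (z₁.im ^ (1 - σ) + z₂.im ^ (1 - σ)) ≤
        -((β₁ + β₂ + δ) * (z₁.im ^ (1 - σ) + z₂.im ^ (1 - σ))) := by
    rw [hu]; linarith
  have habs : (β₁ + β₂ + δ) * 2 ≤ (β₁ + β₂ + δ) * (z₁.im ^ (1 - σ) + z₂.im ^ (1 - σ)) :=
    mul_le_mul_of_nonneg_left (by linarith) hβ
  linarith

/-! ## From `(½, 1)` to `(0, 1)`: reflection and the point `σ = ½` by continuity -/

/-- **Extension to `(0, 1)`.** If `Re Λ_{z₁} + Re Λ_{z₂} < 0` on `(½, 1)` and `≤ −c` (`c > 0`) on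
an initial segment `(½, ½ + ε)`, then `Re Λ_{z₁}(σ) + Re Λ_{z₂}(σ) < 0` for every `0 < σ < 1`:
`(0, ½)` by `Λ_z(1 − s) = Λ_z(s)`, and `σ = ½` by continuity from the right (`Λ_z` is holomorphic
off `{0, 1}`), where the sum is `≤ −c < 0`. (Low's grouping needs the point `σ = ½` exactly where
the principal class alone has the wrong sign, Bateman–Grosswald (10).) [cite: Low1968, Theorem 5 (via MR 38#4425)] -/
theorem re_add_re_neg_of_Ioo_half_one (z₁ z₂ : ℍ) {c ε : ℝ} (hc : 0 < c) (hε : 0 < ε)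
    (hneg : ∀ σ : ℝ, 1 / 2 < σ → σ < 1 →
      ((thetaFEPair z₁).Λ σ).re + ((thetaFEPair z₂).Λ σ).re < 0)
    (hnegc : ∀ σ : ℝ, 1 / 2 < σ → σ < 1 / 2 + ε →
      ((thetaFEPair z₁).Λ σ).re + ((thetaFEPair z₂).Λ σ).re ≤ -c)
    {σ : ℝ} (hσ0 : 0 < σ) (hσ1 : σ < 1) :
    ((thetaFEPair z₁).Λ σ).re + ((thetaFEPair z₂).Λ σ).re < 0 := by
  rcases lt_trichotomy σ (1 / 2) with h | h | h
  · -- reflect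
    rw [← thetaFEPair_Λ_one_sub z₁ (σ : ℂ), ← thetaFEPair_Λ_one_sub z₂ (σ : ℂ),
      show (1 : ℂ) - (σ : ℂ) = ((1 - σ : ℝ) : ℂ) by push_cast; ring]
    exact hneg (1 - σ) (by linarith) (by linarith)
  · -- `σ = ½`: continuity from the right
    subst h
    set g : ℝ → ℝ := fun t => ((thetaFEPair z₁).Λ t).re + ((thetaFEPair z₂).Λ t).re with hg
    have hcont : ContinuousWithinAt g (Icc (1 / 2 : ℝ) (3 / 4)) (1 / 2) := by
      have h1 := continuousOn_re_Λ z₁ (σ₁ := 3 / 4) (by norm_num)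
      have h2 := continuousOn_re_Λ z₂ (σ₁ := 3 / 4) (by norm_num)
      exact (h1.add h2) (1 / 2) ⟨le_rfl, by norm_num⟩
    have hcont' : ContinuousWithinAt g (Ioc (1 / 2 : ℝ) (3 / 4)) (1 / 2) :=
      hcont.mono Ioc_subset_Icc_self
    have htend : Tendsto g (𝓝[>] (1 / 2 : ℝ)) (𝓝 (g (1 / 2))) := by
      have := hcont'.tendsto
      rwa [nhdsWithin_Ioc_eq_nhdsGT (by norm_num : (1 / 2 : ℝ) < 3 / 4)] at this
    have hev : ∀ᶠ t in 𝓝[>] (1 / 2 : ℝ), g t ≤ -c := by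
      filter_upwards [Ioo_mem_nhdsGT (show (1 / 2 : ℝ) < 1 / 2 + ε by linarith)] with t ht
      exact hnegc t ht.1 ht.2
    have hle : g (1 / 2) ≤ -c := le_of_tendsto htend hev
    have : g (1 / 2) = ((thetaFEPair z₁).Λ ((1 / 2 : ℝ) : ℂ)).re +
        ((thetaFEPair z₂).Λ ((1 / 2 : ℝ) : ℂ)).re := rfl
    linarith
  · exact hneg σ h hσ1

/-! ## Transfer to the Epstein zeta functions of two forms of the same discriminant -/

variable {a₁ b₁ c₁ a₂ b₂ c₂ : ℝ}

/-- **Two classes of one discriminant.** If `Re Λ_{z₁}(σ) + Re Λ_{z₂}(σ) < 0` on `(0, 1)` whenever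
`Im z_i = k_i = √|d|/(2a_i)`, then `Re Z₁(σ) + Re Z₂(σ) < 0` on `(0, 1)` for ALL analytic continuations
`Z_i` of `ζ_{Q_i}`, `Q₁`, `Q₂` positive definite forms with the same discriminant: the completing
factor `c(σ) = π^σ(√|d|/2)^{−σ}/Γ(σ) > 0` of `continuation_ofReal_eq` is common to both.
[cite: Low1968, Theorem 5 (via MR 38#4425)] -/
theorem pair_re_neg_of_Λ (h1 : IsPosDefForm a₁ b₁ c₁) (h2 : IsPosDefForm a₂ b₂ c₂)
    (hD : 4 * a₁ * c₁ - b₁ ^ 2 = 4 * a₂ * c₂ - b₂ ^ 2)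
    (hΛ : ∀ z₁ z₂ : ℍ, z₁.im = starkK a₁ b₁ c₁ → z₂.im = starkK a₂ b₂ c₂ →
      ∀ σ : ℝ, 0 < σ → σ < 1 → ((thetaFEPair z₁).Λ σ).re + ((thetaFEPair z₂).Λ σ).re < 0)
    {Z₁ Z₂ : ℂ → ℂ} (hZ1 : IsEpsteinContinuation a₁ b₁ c₁ Z₁)
    (hZ2 : IsEpsteinContinuation a₂ b₂ c₂ Z₂) {σ : ℝ} (hσ0 : 0 < σ) (hσ1 : σ < 1) :
    (Z₁ σ).re + (Z₂ σ).re < 0 := by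
  obtain ⟨z₁, hre1, him1, hk1⟩ := exists_zQ' h1
  obtain ⟨z₂, hre2, him2, hk2⟩ := exists_zQ' h2
  have hZ1' : IsEpsteinContinuation c₁ b₁ a₁ Z₁ := (isEpsteinContinuation_swap_iff a₁ b₁ c₁ Z₁).2 hZ1
  have hZ2' : IsEpsteinContinuation c₂ b₂ a₂ Z₂ := (isEpsteinContinuation_swap_iff a₂ b₂ c₂ Z₂).2 hZ2
  rw [continuation_ofReal_eq h1.swap z₁ hre1 him1 hZ1' hσ0 hσ1,
    continuation_ofReal_eq h2.swap z₂ hre2 him2 hZ2' hσ0 hσ1, Complex.re_ofReal_mul,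
    Complex.re_ofReal_mul]
  have hD' : (4 : ℝ) * c₂ * a₂ - b₂ ^ 2 = 4 * c₁ * a₁ - b₁ ^ 2 := by linarith
  rw [hD', ← mul_add]
  exact mul_neg_of_pos_of_neg (realFactor_pos h1.swap hσ0) (hΛ z₁ z₂ hk1 hk2 σ hσ0 hσ1)

/-! ## The class sum with the principal class grouped -/

section ClassSum

open Literature.NumberTheory.QuadraticFields.BinaryQuadraticForm (reducedForms mem_reducedForms_iff
  le_of_isReduced discr_apply discr IsPrimitive IsReduced isPrimitive_one)
open Literature.NumberTheory.LFunctions (riemannZeta_im_eq_zero_of_pos riemannZeta_re_neg_of_pos_of_lt_one)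

/-- **The principal class is the only reduced class with `a = 1`**: two reduced forms `(1, b, c)`,
`(1, b', c')` of the same negative discriminant coincide (`|b| ≤ 1` with `b = −1` excluded by the
tie-breaking rule, so `b ∈ {0, 1}` is the parity of the discriminant and `c = (b² − D)/4`).
[folklore] -/
private theorem eq_of_mem_reducedForms_of_fst_eq_one {D : ℤ} (hD : D < 0) {Q Q' : ℤ × ℤ × ℤ}
    (hQ : Q ∈ reducedForms D) (hQ' : Q' ∈ reducedForms D) (h1 : Q.1 = 1) (h1' : Q'.1 = 1) :
    Q = Q' := by
  obtain ⟨a, b, c⟩ := Q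
  obtain ⟨a', b', c'⟩ := Q'
  obtain ⟨hdisc, -, -, hb1, hb2, -, hb0⟩ := (mem_reducedForms_iff hD).1 hQ
  obtain ⟨hdisc', -, -, hb1', hb2', -, hb0'⟩ := (mem_reducedForms_iff hD).1 hQ'
  simp only at h1 h1' hb1 hb2 hb0 hb1' hb2' hb0'
  subst h1
  subst h1'
  rw [discr_apply] at hdisc hdisc'
  have hb : b = 0 ∨ b = 1 := by omega
  have hb' : b' = 0 ∨ b' = 1 := by omega
  have hbb : b ^ 2 = b := by rcases hb with h | h <;> subst h <;> norm_num
  have hbb' : b' ^ 2 = b' := by rcases hb' with h | h <;> subst h <;> norm_num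
  rw [hbb] at hdisc
  rw [hbb'] at hdisc'
  have hbe : b = b' := by omega
  subst hbe
  have hce : c = c' := by omega
  subst hce
  rfl

/-- **Every non-principal reduced class of a discriminant `−d` with `4 < d ≤ 576` has
`4/5 ≤ k ≤ 6`** (`a ≥ 2` gives `k = √d/(2a) ≤ √576/4 = 6`), hence its Epstein zeta function is
negative on all of `(0, 1)`, for every continuation. [folklore] -/
private theorem re_neg_of_mem_reducedForms_of_two_le {d : ℕ} (hd : 4 < d) (hd' : d ≤ 576) {a b c : ℤ}
    (hQ : (a, b, c) ∈ reducedForms (-(d : ℤ))) (ha2 : 2 ≤ a) {Z : ℂ → ℂ}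
    (hZ : IsEpsteinContinuation (a : ℝ) (b : ℝ) (c : ℝ) Z) {σ : ℝ}
    (hσ0 : 0 < σ) (hσ1 : σ < 1) : (Z σ).re < 0 := by
  have hD0 : (-(d : ℤ)) < 0 := by omega
  obtain ⟨hdisc, ha, -, hred⟩ := (mem_reducedForms_iff hD0).1 hQ
  obtain ⟨-, hb1, hb2, hac⟩ := le_of_isReduced hdisc ha hred
  simp only at ha
  rw [discr_apply] at hdisc
  have hbsq : b ^ 2 ≤ a ^ 2 := by nlinarith
  have h3a : 3 * a ^ 2 ≤ (d : ℤ) := by nlinarith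
  have haR : (2 : ℝ) ≤ a := by exact_mod_cast ha2
  have hdR : (4 : ℝ) * a * c - (b : ℝ) ^ 2 = d := by
    exact_mod_cast (by linarith : 4 * a * c - b ^ 2 = (d : ℤ))
  have h3aR : 3 * (a : ℝ) ^ 2 ≤ d := by exact_mod_cast h3a
  have hd4R : (4 : ℝ) < d := by exact_mod_cast hd
  have hd576 : (d : ℝ) ≤ 576 := by exact_mod_cast hd'
  have hpos : IsPosDefForm (a : ℝ) (b : ℝ) (c : ℝ) := ⟨by linarith, by linarith⟩
  have hk : starkK (a : ℝ) (b : ℝ) (c : ℝ) = Real.sqrt d / (2 * a) := by rw [starkK, hdR]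
  have hsd24 : Real.sqrt d ≤ 24 := by
    rw [Real.sqrt_le_left (by norm_num)]; linarith
  have hk45 : 4 / 5 ≤ starkK (a : ℝ) (b : ℝ) (c : ℝ) := by
    rw [hk, le_div_iff₀ (by positivity), Real.le_sqrt' (by positivity)]
    nlinarith
  have hk6 : starkK (a : ℝ) (b : ℝ) (c : ℝ) ≤ 6 := by
    rw [hk, div_le_iff₀ (by positivity)]
    nlinarith
  exact re_neg_of_starkK_le_six hpos hk45 hk6 hZ hσ0 hσ1

/-- **Low's grouping, class-number form: `Re L(σ, χ) > 0` on ALL of `(0, 1)`** for the odd real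
primitive character `χ` mod `d`, `4 < d ≤ 576`, provided the principal reduced class `Q₁ = (1, b₁, c₁)`
GROUPED with one other reduced class `Q₂ = (a₂, b₂, c₂)` (`a₂ ≥ 2`) of discriminant `−d` is negative on
`(0, 1)` (`hpair`, for all continuations; the two classes are given by their coefficients, reducedness
and primitivity being decidable): in `ζ(s)L(s, χ) = ½Σ_{Q reduced} Z_Q(s)` (continued to
`ℂ ∖ {1}`) the pair contributes `< 0`, every other class has `a ≥ 2` and contributes `< 0` by itself
(`re_neg_of_mem_reducedForms_of_two_le`), and `ζ(σ) < 0` on `(0, 1)`. The principal class alone has a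
real zero in `(½, 1)` once `d ≥ 200` (`principalForm_realZero`). [cite: Low1968, Theorem 5 (via MR 38#4425)] -/
theorem LFunction_re_pos_of_pair {d : ℕ} [NeZero d] (hd : 4 < d) (hd' : d ≤ 576)
    {χ : DirichletCharacter ℂ d} (hprim : χ.IsPrimitive) (hquad : χ.IsQuadratic) (hodd : χ.Odd)
    {b₁ c₁ a₂ b₂ c₂ : ℤ} (hdisc1 : discr ((1 : ℤ), b₁, c₁) = -(d : ℤ))
    (hred1 : IsReduced ((1 : ℤ), b₁, c₁)) (hdisc2 : discr (a₂, b₂, c₂) = -(d : ℤ))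
    (hprim2 : IsPrimitive (a₂, b₂, c₂)) (hred2 : IsReduced (a₂, b₂, c₂)) (ha2 : 2 ≤ a₂)
    (hpair : ∀ Z₁ Z₂ : ℂ → ℂ, IsEpsteinContinuation (1 : ℝ) (b₁ : ℝ) (c₁ : ℝ) Z₁ →
      IsEpsteinContinuation (a₂ : ℝ) (b₂ : ℝ) (c₂ : ℝ) Z₂ →
      ∀ σ : ℝ, 0 < σ → σ < 1 → (Z₁ σ).re + (Z₂ σ).re < 0)
    {σ : ℝ} (hσ0 : 0 < σ) (hσ1 : σ < 1) : 0 < (χ.LFunction σ).re := by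
  classical
  have hχ1 : χ ≠ 1 := by
    intro h
    have h1 : χ (-1) = -1 := hodd
    rw [h, MulChar.one_apply (isUnit_one.neg)] at h1
    norm_num at h1
  set S := reducedForms (-(d : ℤ)) with hS
  have hD0 : (-(d : ℤ)) < 0 := by omega
  have hQ1 : ((1 : ℤ), b₁, c₁) ∈ S :=
    (mem_reducedForms_iff hD0).2 ⟨hdisc1, by norm_num, isPrimitive_one _ _, hred1⟩
  have hQ2 : (a₂, b₂, c₂) ∈ S :=
    (mem_reducedForms_iff hD0).2 ⟨hdisc2, by simp only; omega, hprim2, hred2⟩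
  have huniq : ∀ Q ∈ S, Q.1 = 1 → Q = (1, b₁, c₁) := fun Q hQ h1 =>
    eq_of_mem_reducedForms_of_fst_eq_one hD0 hQ hQ1 h1 rfl
  -- continuations of the class zeta functions
  have hex : ∀ Q : ℤ × ℤ × ℤ, ∃ Z : ℂ → ℂ,
      Q ∈ S → IsEpsteinContinuation (Q.1 : ℝ) (Q.2.1 : ℝ) (Q.2.2 : ℝ) Z := by
    intro Q
    by_cases hQ : Q ∈ S
    · obtain ⟨hdisc, ha, -, hred⟩ := (mem_reducedForms_iff hD0).1 hQ
      obtain ⟨-, hb1, hb2, hac⟩ := le_of_isReduced (a := Q.1) (b := Q.2.1) (c := Q.2.2) hdisc ha hred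
      rw [show Q = (Q.1, Q.2.1, Q.2.2) from rfl, discr_apply] at hdisc
      have hd4R : (4 : ℝ) < d := by exact_mod_cast hd
      have hpos : IsPosDefForm (Q.1 : ℝ) (Q.2.1 : ℝ) (Q.2.2 : ℝ) := by
        refine ⟨by exact_mod_cast ha, ?_⟩
        have : (Q.2.1 : ℝ) ^ 2 - 4 * (Q.1 : ℝ) * (Q.2.2 : ℝ) = ((-(d : ℤ) : ℤ) : ℝ) := by
          exact_mod_cast hdisc
        rw [this]; push_cast; linarith
      obtain ⟨Z, hZ, -⟩ := MontgomeryVaughan2007_epsteinContinuation_holds _ _ _ hpos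
      exact ⟨Z, fun _ => hZ⟩
    · exact ⟨0, fun h => absurd h hQ⟩
  choose Z hZ using hex
  set G : ℂ → ℂ := fun s => 1 / 2 * ∑ Q ∈ S, Z Q s with hGdef
  set F : ℂ → ℂ := fun s => riemannZeta s * χ.LFunction s with hFdef
  have hU : IsOpen {s : ℂ | s ≠ 1} := isOpen_ne
  have hFd : DifferentiableOn ℂ F {s : ℂ | s ≠ 1} := fun s hs =>
    ((differentiableAt_riemannZeta hs).mul
      ((DirichletCharacter.differentiable_LFunction hχ1) s)).differentiableWithinAt
  have hGd : DifferentiableOn ℂ G {s : ℂ | s ≠ 1} :=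
    (differentiableOn_const _).mul (DifferentiableOn.fun_sum fun Q hQ => (hZ Q hQ).1)
  have hFG : EqOn F G {s : ℂ | s ≠ 1} := by
    refine (hFd.analyticOnNhd hU).eqOn_of_preconnected_of_eventuallyEq (hGd.analyticOnNhd hU)
      isPreconnected_compl_one (show (2 : ℂ) ∈ {s : ℂ | s ≠ 1} by norm_num) ?_
    have hopen : IsOpen {s : ℂ | 1 < s.re} := isOpen_lt continuous_const Complex.continuous_re
    filter_upwards [hopen.mem_nhds (show (2 : ℂ) ∈ {s : ℂ | 1 < s.re} by simp)] with s hs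
    have hs' : 1 < s.re := hs
    simp only [hFdef, hGdef]
    rw [riemannZeta_mul_LFunction_eq_half_sum_of_one_lt_re hd hprim hquad hodd hs']
    congr 1
    exact Finset.sum_congr rfl fun Q hQ => ((hZ Q hQ).2 s hs').symm
  -- at the real point `σ`
  have hσU : ((σ : ℂ)) ∈ {s : ℂ | s ≠ 1} := by
    simp only [Set.mem_setOf_eq]
    exact_mod_cast hσ1.ne
  have heq := hFG hσU
  simp only [hFdef, hGdef] at heq
  -- split off the pair `Q₁, Q₂`
  set Q₁ : ℤ × ℤ × ℤ := ((1 : ℤ), b₁, c₁) with hQ₁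
  set Q₂ : ℤ × ℤ × ℤ := (a₂, b₂, c₂) with hQ₂
  have hne : Q₁ ≠ Q₂ := by
    intro h
    have := congrArg Prod.fst h
    simp only [hQ₁, hQ₂] at this
    omega
  have hQ2' : Q₂ ∈ S.erase Q₁ := Finset.mem_erase.2 ⟨hne.symm, hQ2⟩
  have hsum : ∑ Q ∈ S, (Z Q σ).re =
      (Z Q₁ σ).re + ((Z Q₂ σ).re + ∑ Q ∈ (S.erase Q₁).erase Q₂, (Z Q σ).re) := by
    rw [← Finset.add_sum_erase S _ hQ1, ← Finset.add_sum_erase _ _ hQ2']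
  have hrest : ∑ Q ∈ (S.erase Q₁).erase Q₂, (Z Q σ).re ≤ 0 := by
    refine Finset.sum_nonpos fun Q hQ => ?_
    have hQS : Q ∈ S := Finset.mem_of_mem_erase (Finset.mem_of_mem_erase hQ)
    have hQ1ne : Q ≠ Q₁ := Finset.ne_of_mem_erase (Finset.mem_of_mem_erase hQ)
    obtain ⟨-, ha, -, -⟩ := (mem_reducedForms_iff hD0).1 hQS
    have ha2' : 2 ≤ Q.1 := by
      by_contra hlt
      have h1 : Q.1 = 1 := by omega
      exact hQ1ne (huniq Q hQS h1)
    exact (re_neg_of_mem_reducedForms_of_two_le hd hd' (a := Q.1) (b := Q.2.1) (c := Q.2.2) hQS ha2'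
      (hZ Q hQS) hσ0 hσ1).le
  have hpair' : (Z Q₁ σ).re + (Z Q₂ σ).re < 0 := by
    have h1 := hZ Q₁ hQ1
    have h2 := hZ Q₂ hQ2
    simp only [hQ₁, hQ₂, Int.cast_one] at h1 h2
    exact hpair _ _ h1 h2 σ hσ0 hσ1
  have hGneg : (1 / 2 * ∑ Q ∈ S, Z Q σ).re < 0 := by
    rw [show (1 : ℂ) / 2 = ((1 / 2 : ℝ) : ℂ) by push_cast; ring, Complex.re_ofReal_mul, Complex.re_sum,
      hsum]
    have : (Z Q₁ σ).re + ((Z Q₂ σ).re + ∑ Q ∈ (S.erase Q₁).erase Q₂, (Z Q σ).re) < 0 := by linarith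
    exact mul_neg_of_pos_of_neg (by norm_num) this
  rw [← heq, Complex.mul_re, riemannZeta_im_eq_zero_of_pos hσ0 hσ1.ne, zero_mul, sub_zero] at hGneg
  exact pos_of_mul_neg_right hGneg (riemannZeta_re_neg_of_pos_of_lt_one hσ0 hσ1).le

end ClassSum

end Literature.Barriers.RiemannHypothesis
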